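import Literature.AlgebraicGeometry.Motives.HodgeStructureCentralizerRestrictionToRepresentativesPoints
import HarnessLib

/-!
# MILNE'S PROPOSITION 1.5 ON `K`-POINTS, CANONICAL FORM: for every field `K ⊇ ℚ`, restriction to the (base-changed)
# representatives is an isomorphism of groups `S(H)(K) ⥲ Π_{k ∈ κ} S(T_k)(K)`, `(ι_k)_K ((F g)_k x) = g ((ι_k)_K x)` —
# «`S'(A) ≅ S(A)_{/k'}`» and «an immediate consequence of Proposition 1.1»: `S(·)(K) = {γ ∈ C(·)(K) | γ†γ = 1}` is functorial in the
# `K`-algebra with involution `(C(·)(K), †_K)` (Milne 1999 §1 p. 644 L16–L28, Prop. 1.5, Remark 1.6)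

[topic AlgebraicGeometry/Motives]

Layer `Literature/AlgebraicGeometry/Motives`, lane `lit-hodgefound` (Track 2 foundations library; prover seat
`lit-hodgefound-p02`, generation 53, self-proposed row g53-#7). THEOREMS ONLY: no definition, no named fact (net debt `0`),
no instance, no notation.  The `K`-points companion of g53-#2 (`Motives/HodgeStructureLefschetzGroupRestrictionToRepresentatives`:
`S(H)(ℚ) ≃* Π_k S(T_k)(ℚ)`, `(e g)_k v = g v`) and the FORMULA version of g52-#9's bare
`Polarization.nonempty_lefschetzGroupBaseChange_mulEquiv_pi_of_labelling` (`Motives/HodgeStructureLefschetzGroupInternalBlocksPoints`).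
Deduced, exactly as Milne deduces Prop. 1.5 from Prop. 1.1, from g53-#6's restriction isomorphism of `K`-algebras with involution
`E : C(H)(K) ≃ₐ[K] Π_k C(T_k)(K)`, `(ι_k)_K ((E c)_k x) = c ((ι_k)_K x)`, `(E c^{†_K})_k = ((E c)_k)^{†_K}`
(`Motives/HodgeStructureCentralizerRestrictionToRepresentativesPoints`), through p34's description of the `K`-points
«`S(A)(K) = {γ ∈ C(A) ⊗ K | γ†γ = 1}`» (`Polarization.mem_lefschetzGroupBaseChange_iff_adjointBaseChange_mul_self_eq_one`,
`Polarization.coe_mem_centralizer_of_mem_lefschetzGroupBaseChange`, `Polarization.exists_mem_lefschetzGroupBaseChange_coe_eq`,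
`Polarization.centralizerAdjoint`; `Motives/HodgeStructurePolarizationAdjointPoints`, `…EndAlgCentralizerUnitaryGeneration`,
`…EndAlgCentralizerInvolutionMatrixPairs`) — all joined BY NAME, nothing restated.

## The source, verbatim

J. S. Milne, *Lefschetz classes on abelian varieties*, Duke Math. J. 96 (1999) 639–675 [Milne1999LefschetzClasses] (held
`paper:doi-10-1215-s0012-7094-99-09620-5`), §1 p. 644 L16–L21: "we define `S(A)` to be the algebraic subgroup of `GL(V(A))` such
that, for all commutative `k`-algebras `R`, `S(A)(R) = {γ ∈ C(A) ⊗_k R | γ†γ = 1}`. […] Clearly `S(A)` depends only on the isogeny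
class of `A` (up to a unique isomorphism)."; L24–L28: "**Proposition 1.5.** Let `A₁, …, A_s` be a set of representatives for the
simple isogeny factors of `A` […]. Any such isogeny induces an isomorphism `S(A₁) × ⋯ × S(A_s) → S(A)`, which is independent of the
choice of the isogeny. *Proof.* This is an immediate consequence of Proposition 1.1."; L29–L34: "**Remark 1.6.** […] If `C'(A)` and
`S'(A)` denote the objects defined relative to the second theory, then there are canonical isomorphisms `C'(A) ≅ C(A) ⊗_k k'`,
`S'(A) ≅ S(A)_{/k'}`."  Also H. Lange [Lange2023AbelianVarietiesComplex] §7.2.4 Exercise (4) (the Lefschetz group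
`{γ ∈ Sp | γ commutes with End}`), D. Huybrechts [Huybrechts2016K3] §3.3.5 eq. (3.3).

## Dictionary and what is proved (namespace `Literature.AlgebraicGeometry.Motives.HodgeStructure`)

`C(H)(K) = Subalgebra.centralizer K {a_K : a ∈ E_φ(H)} ⊆ End_K(K ⊗_ℚ V)`, `S(H, Q)(K) = Q.lefschetzGroupBaseChange K ≤ GL(K ⊗_ℚ V)`,
`†_K = Q.adjointBaseChange K` (on `C(H)(K)`: `Q.centralizerAdjoint K`), `(ι_k)_K = (T k).toSubmodule.subtype.baseChange K`.

* §1 («an immediate consequence of Proposition 1.1», on `K`-points)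
  **`Polarization.exists_lefschetzGroupBaseChange_mulEquiv_coe_eq_of_algEquiv_centralizerAdjoint`** (an isomorphism of
  `K`-algebras `e : C(H₁)(K) ≃ₐ[K] C(H₂)(K)` with `e(c^{†}) = (e c)^{†}` induces `S(H₁, Q₁)(K) ≃* S(H₂, Q₂)(K)`, `↑(E g) = e ↑g`),
  **`Polarization.exists_mulEquiv_pi_lefschetzGroupBaseChange_of_algEquiv_centralizerAdjoint`** (the same into a PRODUCT:
  `E : C(H)(K) ≃ₐ[K] Π_k C(H_k)(K)` with `(E c^{†})_k = ((E c)_k)^{†}` induces `F : S(H)(K) ≃* Π_k S(H_k)(K)`, `↑((F g)_k) = (E ↑g)_k`).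
* §2 `Polarization.lefschetzGroupBaseChange_pi_eq_of_forall_baseChange_apply` («independent of the choice»: two maps over the
  base-changed restrictions coincide — `(ι_k)_K` is injective, `K` being flat over `ℚ`),
  `Polarization.subtype_baseChange_apply_eq_symm_apply_of_forall_baseChange_apply` (the inverse glues).
* §3 (isotypically labelled irreducible decomposition `V = ⊕ᵢ Tᵢ` of a polarized `H`)
  **`Polarization.exists_mulEquiv_pi_lefschetzGroupBaseChange_of_labelling : ∃ F : S(H, ψ)(K) ≃* Π k : κ, S(T_k, ψ|_{T_k})(K),
  ∀ g k x, (ι_k)_K ((F g)_k x) = g ((ι_k)_K x)`** (PROP. 1.5 ON `K`-POINTS, CANONICAL FORM),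
  `Polarization.existsUnique_mem_lefschetzGroupBaseChange_forall_baseChange_apply` (every family `δ_k ∈ S(T_k)(K)` is the
  family of restrictions of a unique `g ∈ S(H)(K)`).
-/

noncomputable section

open scoped TensorProduct

namespace Literature.AlgebraicGeometry.Motives

namespace HodgeStructure

universe u u' u'' uK

variable (K : Type uK) [Field K] [Algebra ℚ K]

/-! ## §1 `S(·)(K) = {γ ∈ C(·)(K) | γ†γ = 1}` is functorial in the `K`-algebra with involution `(C(·)(K), †_K)` -/

section Functorial

variable {V₁ : Type u} [AddCommGroup V₁] [Module ℚ V₁] [Module.Finite ℚ V₁] {n₁ : ℤ} {H₁ : HodgeStructure V₁ n₁}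
  {V₂ : Type u'} [AddCommGroup V₂] [Module ℚ V₂] [Module.Finite ℚ V₂] {n₂ : ℤ} {H₂ : HodgeStructure V₂ n₂}
  {κ : Type u''} {W : κ → Type u'} [∀ k, AddCommGroup (W k)] [∀ k, Module ℚ (W k)] [∀ k, Module.Finite ℚ (W k)]
  {m : κ → ℤ} {H' : ∀ k, HodgeStructure (W k) (m k)}

/-- **«An immediate consequence of Proposition 1.1», on `K`-points: `S(·)(K) = {γ ∈ C(·)(K) | γ†γ = 1}` is functorial in the
`K`-algebra with involution.**  An isomorphism of `K`-algebras `e : C(H₁)(K) ≃ₐ[K] C(H₂)(K)` compatible with the `K`-adjoints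
(`e (c^{†₁}) = (e c)^{†₂}`) induces an isomorphism of groups `E : S(H₁, Q₁)(K) ≃* S(H₂, Q₂)(K)` lying over it, `↑(E g) = e ↑g`:
for `g ∈ S(H₁)(K)`, `↑g ∈ C(H₁)(K)` with `g†g = 1`, so `(e ↑g)† (e ↑g) = e(g†g) = 1` and the unitary `e ↑g ∈ C(H₂)(K)` is an
automorphism of the finite-dimensional `K ⊗ V₂` lying in `S(H₂)(K)`; symmetrically for `e⁻¹`.
[cite: Milne1999LefschetzClasses, §1 p. 644 L16–L21 and Prop. 1.5 with its proof (p. 644 L24–L28)]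
[cite: Lange2023AbelianVarietiesComplex, §7.2.4 Exercise (4)] -/
theorem Polarization.exists_lefschetzGroupBaseChange_mulEquiv_coe_eq_of_algEquiv_centralizerAdjoint
    (Q₁ : Polarization H₁) (Q₂ : Polarization H₂)
    (e : Subalgebra.centralizer K ((fun a : Module.End ℚ V₁ => a.baseChange K) '' (H₁.endAlg : Set (Module.End ℚ V₁))) ≃ₐ[K]
      Subalgebra.centralizer K ((fun a : Module.End ℚ V₂ => a.baseChange K) '' (H₂.endAlg : Set (Module.End ℚ V₂))))
    (he : ∀ c : Subalgebra.centralizer K ((fun a : Module.End ℚ V₁ => a.baseChange K) '' (H₁.endAlg : Set (Module.End ℚ V₁))),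
      ((e (Q₁.centralizerAdjoint K c) : Subalgebra.centralizer K ((fun a : Module.End ℚ V₂ => a.baseChange K) ''
          (H₂.endAlg : Set (Module.End ℚ V₂)))) : Module.End K (K ⊗[ℚ] V₂)) =
        Q₂.adjointBaseChange K ((e c : Subalgebra.centralizer K ((fun a : Module.End ℚ V₂ => a.baseChange K) ''
          (H₂.endAlg : Set (Module.End ℚ V₂)))) : Module.End K (K ⊗[ℚ] V₂))) :
    ∃ E : Q₁.lefschetzGroupBaseChange K ≃* Q₂.lefschetzGroupBaseChange K,
      ∀ g : Q₁.lefschetzGroupBaseChange K,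
        (((E g : Q₂.lefschetzGroupBaseChange K) : (K ⊗[ℚ] V₂) ≃ₗ[K] (K ⊗[ℚ] V₂)) : Module.End K (K ⊗[ℚ] V₂)) =
          ((e ⟨((g : (K ⊗[ℚ] V₁) ≃ₗ[K] (K ⊗[ℚ] V₁)) : Module.End K (K ⊗[ℚ] V₁)),
              Q₁.coe_mem_centralizer_of_mem_lefschetzGroupBaseChange K g.2⟩ : Subalgebra.centralizer K
                ((fun a : Module.End ℚ V₂ => a.baseChange K) '' (H₂.endAlg : Set (Module.End ℚ V₂)))) :
            Module.End K (K ⊗[ℚ] V₂)) := by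
  -- `↑g ∈ C(H₁)(K)` for `g ∈ S(H₁)(K)`, and symmetrically
  obtain ⟨c₁, hc₁⟩ : ∃ c₁ : Q₁.lefschetzGroupBaseChange K →
      Subalgebra.centralizer K ((fun a : Module.End ℚ V₁ => a.baseChange K) '' (H₁.endAlg : Set (Module.End ℚ V₁))),
      ∀ g, (c₁ g : Module.End K (K ⊗[ℚ] V₁)) = ((g : (K ⊗[ℚ] V₁) ≃ₗ[K] (K ⊗[ℚ] V₁)) : Module.End K (K ⊗[ℚ] V₁)) :=
    ⟨fun g => ⟨_, Q₁.coe_mem_centralizer_of_mem_lefschetzGroupBaseChange K g.2⟩, fun _ => rfl⟩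
  obtain ⟨c₂, hc₂⟩ : ∃ c₂ : Q₂.lefschetzGroupBaseChange K →
      Subalgebra.centralizer K ((fun a : Module.End ℚ V₂ => a.baseChange K) '' (H₂.endAlg : Set (Module.End ℚ V₂))),
      ∀ g, (c₂ g : Module.End K (K ⊗[ℚ] V₂)) = ((g : (K ⊗[ℚ] V₂) ≃ₗ[K] (K ⊗[ℚ] V₂)) : Module.End K (K ⊗[ℚ] V₂)) :=
    ⟨fun g => ⟨_, Q₂.coe_mem_centralizer_of_mem_lefschetzGroupBaseChange K g.2⟩, fun _ => rfl⟩
  have he' : ∀ c, e (Q₁.centralizerAdjoint K c) = Q₂.centralizerAdjoint K (e c) := fun c => Subtype.ext (he c)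
  have hesymm : ∀ d, e.symm (Q₂.centralizerAdjoint K d) = Q₁.centralizerAdjoint K (e.symm d) := fun d =>
    e.injective (by rw [e.apply_symm_apply, he', e.apply_symm_apply])
  -- `g†g = 1` on both sides
  have hu₁ : ∀ g, Q₁.centralizerAdjoint K (c₁ g) * c₁ g = 1 := fun g => by
    rw [Q₁.centralizerAdjoint_mul_self_eq_one_iff K, hc₁]
    exact ((Q₁.mem_lefschetzGroupBaseChange_iff_adjointBaseChange_mul_self_eq_one K _).1 g.2).2
  have hu₂ : ∀ g, Q₂.centralizerAdjoint K (c₂ g) * c₂ g = 1 := fun g => by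
    rw [Q₂.centralizerAdjoint_mul_self_eq_one_iff K, hc₂]
    exact ((Q₂.mem_lefschetzGroupBaseChange_iff_adjointBaseChange_mul_self_eq_one K _).1 g.2).2
  -- `e ↑g` and `e⁻¹ ↑g'` are unitary, hence underlie elements of `S(H₂)(K)`, `S(H₁)(K)`
  have hfwd : ∀ g, Q₂.centralizerAdjoint K (e (c₁ g)) * e (c₁ g) = 1 := fun g => by
    rw [← he', ← map_mul, hu₁, map_one]
  have hbwd : ∀ g', Q₁.centralizerAdjoint K (e.symm (c₂ g')) * e.symm (c₂ g') = 1 := fun g' => by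
    rw [← hesymm, ← map_mul, hu₂, map_one]
  choose f hfS hf using fun g => Q₂.exists_mem_lefschetzGroupBaseChange_coe_eq K (hfwd g)
  choose b hbS hb using fun g' => Q₁.exists_mem_lefschetzGroupBaseChange_coe_eq K (hbwd g')
  have hfc : ∀ g, c₂ ⟨f g, hfS g⟩ = e (c₁ g) := fun g => Subtype.ext (by rw [hc₂]; exact hf g)
  have hbc : ∀ g', c₁ ⟨b g', hbS g'⟩ = e.symm (c₂ g') := fun g' => Subtype.ext (by rw [hc₁]; exact hb g')
  refine ⟨{ toFun := fun g => ⟨f g, hfS g⟩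
            invFun := fun g' => ⟨b g', hbS g'⟩
            left_inv := fun g => ?_
            right_inv := fun g' => ?_
            map_mul' := fun g g' => ?_ }, fun g => ?_⟩
  · -- `e⁻¹ (e ↑g) = ↑g`
    apply Subtype.ext
    apply LinearEquiv.toLinearMap_injective
    change ((b ⟨f g, hfS g⟩ : (K ⊗[ℚ] V₁) ≃ₗ[K] (K ⊗[ℚ] V₁)) : Module.End K (K ⊗[ℚ] V₁)) =
      ((g : (K ⊗[ℚ] V₁) ≃ₗ[K] (K ⊗[ℚ] V₁)) : Module.End K (K ⊗[ℚ] V₁))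
    rw [hb, hfc, e.symm_apply_apply, hc₁]
  · -- `e (e⁻¹ ↑g') = ↑g'`
    apply Subtype.ext
    apply LinearEquiv.toLinearMap_injective
    change ((f ⟨b g', hbS g'⟩ : (K ⊗[ℚ] V₂) ≃ₗ[K] (K ⊗[ℚ] V₂)) : Module.End K (K ⊗[ℚ] V₂)) =
      ((g' : (K ⊗[ℚ] V₂) ≃ₗ[K] (K ⊗[ℚ] V₂)) : Module.End K (K ⊗[ℚ] V₂))
    rw [hf, hbc, e.apply_symm_apply, hc₂]
  · -- multiplicativity: `e` is multiplicative, and so are the coercions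
    apply Subtype.ext
    apply LinearEquiv.toLinearMap_injective
    change ((f (g * g') : (K ⊗[ℚ] V₂) ≃ₗ[K] (K ⊗[ℚ] V₂)) : Module.End K (K ⊗[ℚ] V₂)) =
      ((f g * f g' : (K ⊗[ℚ] V₂) ≃ₗ[K] (K ⊗[ℚ] V₂)) : Module.End K (K ⊗[ℚ] V₂))
    have hmul : c₁ (g * g') = c₁ g * c₁ g' := Subtype.ext (by
      rw [hc₁, Subalgebra.coe_mul, hc₁, hc₁, Subgroup.coe_mul, LinearEquiv.coe_toLinearMap_mul])
    rw [hf, hmul, map_mul, Subalgebra.coe_mul, LinearEquiv.coe_toLinearMap_mul, hf, hf]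
  · -- the formula `↑(E g) = e ↑g`
    change ((f g : (K ⊗[ℚ] V₂) ≃ₗ[K] (K ⊗[ℚ] V₂)) : Module.End K (K ⊗[ℚ] V₂)) = _
    have hg : c₁ g = ⟨_, Q₁.coe_mem_centralizer_of_mem_lefschetzGroupBaseChange K g.2⟩ := Subtype.ext (hc₁ g)
    rw [hf, hg]

/-- **The same into a PRODUCT of `K`-algebras with involution** (the shape of Prop. 1.1 ∕ 1.5): an isomorphism of `K`-algebras
`E : C(H)(K) ≃ₐ[K] Π_k C(H_k)(K)` with `(E c^{†})_k = ((E c)_k)^{†_k}` for all `k` induces an isomorphism of groups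
`F : S(H, Q)(K) ≃* Π_k S(H_k, Q_k)(K)` lying over it, `↑((F g)_k) = (E ↑g)_k` — `((E ↑g)_k)^† (E ↑g)_k = (E (g†g))_k = 1`, and a
family of unitaries `(δ_k)_k` comes from the unitary `E⁻¹((↑δ_k)_k)`. [cite: Milne1999LefschetzClasses, §1 Prop. 1.5 and its proof (p. 644 L24–L28)]
[cite: Lange2023AbelianVarietiesComplex, §7.2.4 Exercise (4)] -/
theorem Polarization.exists_mulEquiv_pi_lefschetzGroupBaseChange_of_algEquiv_centralizerAdjoint
    (Q : Polarization H₁) (Q' : ∀ k, Polarization (H' k))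
    (E : Subalgebra.centralizer K ((fun a : Module.End ℚ V₁ => a.baseChange K) '' (H₁.endAlg : Set (Module.End ℚ V₁))) ≃ₐ[K]
      Π k, Subalgebra.centralizer K ((fun a : Module.End ℚ (W k) => a.baseChange K) '' ((H' k).endAlg : Set (Module.End ℚ (W k)))))
    (hE : ∀ (c : Subalgebra.centralizer K ((fun a : Module.End ℚ V₁ => a.baseChange K) '' (H₁.endAlg : Set (Module.End ℚ V₁))))
      (k : κ),
      ((E (Q.centralizerAdjoint K c) k : Subalgebra.centralizer K ((fun a : Module.End ℚ (W k) => a.baseChange K) ''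
          ((H' k).endAlg : Set (Module.End ℚ (W k))))) : Module.End K (K ⊗[ℚ] W k)) =
        (Q' k).adjointBaseChange K ((E c k : Subalgebra.centralizer K ((fun a : Module.End ℚ (W k) => a.baseChange K) ''
          ((H' k).endAlg : Set (Module.End ℚ (W k))))) : Module.End K (K ⊗[ℚ] W k))) :
    ∃ F : Q.lefschetzGroupBaseChange K ≃* Π k, (Q' k).lefschetzGroupBaseChange K,
      ∀ (g : Q.lefschetzGroupBaseChange K) (k : κ),
        (((F g k : (Q' k).lefschetzGroupBaseChange K) : (K ⊗[ℚ] W k) ≃ₗ[K] (K ⊗[ℚ] W k)) : Module.End K (K ⊗[ℚ] W k)) =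
          ((E ⟨((g : (K ⊗[ℚ] V₁) ≃ₗ[K] (K ⊗[ℚ] V₁)) : Module.End K (K ⊗[ℚ] V₁)),
              Q.coe_mem_centralizer_of_mem_lefschetzGroupBaseChange K g.2⟩ k : Subalgebra.centralizer K
                ((fun a : Module.End ℚ (W k) => a.baseChange K) '' ((H' k).endAlg : Set (Module.End ℚ (W k))))) :
            Module.End K (K ⊗[ℚ] W k)) := by
  obtain ⟨cH, hcH⟩ : ∃ cH : Q.lefschetzGroupBaseChange K →
      Subalgebra.centralizer K ((fun a : Module.End ℚ V₁ => a.baseChange K) '' (H₁.endAlg : Set (Module.End ℚ V₁))),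
      ∀ g, (cH g : Module.End K (K ⊗[ℚ] V₁)) = ((g : (K ⊗[ℚ] V₁) ≃ₗ[K] (K ⊗[ℚ] V₁)) : Module.End K (K ⊗[ℚ] V₁)) :=
    ⟨fun g => ⟨_, Q.coe_mem_centralizer_of_mem_lefschetzGroupBaseChange K g.2⟩, fun _ => rfl⟩
  obtain ⟨cW, hcW⟩ : ∃ cW : (Π k, (Q' k).lefschetzGroupBaseChange K) →
      Π k, Subalgebra.centralizer K ((fun a : Module.End ℚ (W k) => a.baseChange K) '' ((H' k).endAlg : Set (Module.End ℚ (W k)))),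
      ∀ δ k, (cW δ k : Module.End K (K ⊗[ℚ] W k)) = ((δ k : (K ⊗[ℚ] W k) ≃ₗ[K] (K ⊗[ℚ] W k)) : Module.End K (K ⊗[ℚ] W k)) :=
    ⟨fun δ k => ⟨_, (Q' k).coe_mem_centralizer_of_mem_lefschetzGroupBaseChange K (δ k).2⟩, fun _ _ => rfl⟩
  have hE' : ∀ c k, E (Q.centralizerAdjoint K c) k = (Q' k).centralizerAdjoint K (E c k) := fun c k => Subtype.ext (hE c k)
  -- `g†g = 1` on both sides
  have huH : ∀ g, Q.centralizerAdjoint K (cH g) * cH g = 1 := fun g => by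
    rw [Q.centralizerAdjoint_mul_self_eq_one_iff K, hcH]
    exact ((Q.mem_lefschetzGroupBaseChange_iff_adjointBaseChange_mul_self_eq_one K _).1 g.2).2
  have huW : ∀ δ k, (Q' k).centralizerAdjoint K (cW δ k) * cW δ k = 1 := fun δ k => by
    rw [(Q' k).centralizerAdjoint_mul_self_eq_one_iff K, hcW]
    exact (((Q' k).mem_lefschetzGroupBaseChange_iff_adjointBaseChange_mul_self_eq_one K _).1 (δ k).2).2
  -- `(E ↑g)_k` is unitary for every `k`; `E⁻¹ ((↑δ_k)_k)` is unitary
  have hfwd : ∀ g k, (Q' k).centralizerAdjoint K (E (cH g) k) * E (cH g) k = 1 := fun g k => by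
    rw [← hE', ← Pi.mul_apply, ← map_mul, huH, map_one, Pi.one_apply]
  have hbwd : ∀ δ, Q.centralizerAdjoint K (E.symm (cW δ)) * E.symm (cW δ) = 1 := fun δ => by
    apply E.injective
    rw [map_mul, map_one, E.apply_symm_apply]
    funext k
    rw [Pi.mul_apply, Pi.one_apply, hE', E.apply_symm_apply, huW]
  choose f hfS hf using fun g k => (Q' k).exists_mem_lefschetzGroupBaseChange_coe_eq K (hfwd g k)
  choose b hbS hb using fun δ => Q.exists_mem_lefschetzGroupBaseChange_coe_eq K (hbwd δ)
  have hfc : ∀ g, (cW fun k => ⟨f g k, hfS g k⟩) = E (cH g) := fun g =>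
    funext fun k => Subtype.ext (by rw [hcW]; exact hf g k)
  have hbc : ∀ δ, cH ⟨b δ, hbS δ⟩ = E.symm (cW δ) := fun δ => Subtype.ext (by rw [hcH]; exact hb δ)
  refine ⟨{ toFun := fun g k => ⟨f g k, hfS g k⟩
            invFun := fun δ => ⟨b δ, hbS δ⟩
            left_inv := fun g => ?_
            right_inv := fun δ => ?_
            map_mul' := fun g g' => ?_ }, fun g k => ?_⟩
  · -- `E⁻¹ (E ↑g) = ↑g`
    apply Subtype.ext
    apply LinearEquiv.toLinearMap_injective
    change ((b fun k => ⟨f g k, hfS g k⟩ : (K ⊗[ℚ] V₁) ≃ₗ[K] (K ⊗[ℚ] V₁)) : Module.End K (K ⊗[ℚ] V₁)) =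
      ((g : (K ⊗[ℚ] V₁) ≃ₗ[K] (K ⊗[ℚ] V₁)) : Module.End K (K ⊗[ℚ] V₁))
    rw [hb, hfc, E.symm_apply_apply, hcH]
  · -- `E (E⁻¹ δ) = δ`
    funext k
    apply Subtype.ext
    apply LinearEquiv.toLinearMap_injective
    change ((f ⟨b δ, hbS δ⟩ k : (K ⊗[ℚ] W k) ≃ₗ[K] (K ⊗[ℚ] W k)) : Module.End K (K ⊗[ℚ] W k)) =
      ((δ k : (K ⊗[ℚ] W k) ≃ₗ[K] (K ⊗[ℚ] W k)) : Module.End K (K ⊗[ℚ] W k))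
    rw [hf, hbc, E.apply_symm_apply, hcW]
  · -- multiplicativity
    funext k
    apply Subtype.ext
    apply LinearEquiv.toLinearMap_injective
    change ((f (g * g') k : (K ⊗[ℚ] W k) ≃ₗ[K] (K ⊗[ℚ] W k)) : Module.End K (K ⊗[ℚ] W k)) =
      ((f g k * f g' k : (K ⊗[ℚ] W k) ≃ₗ[K] (K ⊗[ℚ] W k)) : Module.End K (K ⊗[ℚ] W k))
    have hmul : cH (g * g') = cH g * cH g' := Subtype.ext (by
      rw [hcH, Subalgebra.coe_mul, hcH, hcH, Subgroup.coe_mul, LinearEquiv.coe_toLinearMap_mul])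
    rw [hf, hmul, map_mul, Pi.mul_apply, Subalgebra.coe_mul, LinearEquiv.coe_toLinearMap_mul, hf, hf]
  · -- the formula `↑((F g)_k) = (E ↑g)_k`
    change ((f g k : (K ⊗[ℚ] W k) ≃ₗ[K] (K ⊗[ℚ] W k)) : Module.End K (K ⊗[ℚ] W k)) = _
    have hg : cH g = ⟨_, Q.coe_mem_centralizer_of_mem_lefschetzGroupBaseChange K g.2⟩ := Subtype.ext (hcH g)
    rw [hf, hg]

end Functorial

/-! ## §2 «Independent of the choice»: maps over the base-changed restrictions are unique, and the inverse glues -/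

section Any

variable {V : Type u} [AddCommGroup V] [Module ℚ V] {n : ℤ} {H : HodgeStructure V n} {ι : Type*} {κ : Finset ι}
  (T : ι → SubHodgeStructure H) (ψ : Polarization H)

/-- **«independent of the choice of the isogeny»**, on `K`-points: two maps `F, F' : S(H)(K) → Π_{k ∈ κ} S(T_k)(K)` both lying over
the base-changed restrictions (`(ι_k)_K ((F g)_k x) = g ((ι_k)_K x) = (ι_k)_K ((F' g)_k x)`) COINCIDE — `(ι_k)_K : K ⊗ T_k → K ⊗ V` is
injective, `K` being flat over `ℚ`. [cite: Milne1999LefschetzClasses, §1 p. 644 L20–L21, Prop. 1.5 and Remark 1.6]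
[cite: BourbakiAlgebraI1989, Ch. II §5 no. 3 Prop. 7] -/
theorem Polarization.lefschetzGroupBaseChange_pi_eq_of_forall_baseChange_apply
    (F F' : ψ.lefschetzGroupBaseChange K → Π k : κ, (ψ.restrict (T k)).lefschetzGroupBaseChange K)
    (hF : ∀ (g : ψ.lefschetzGroupBaseChange K) (k : κ) (x : K ⊗[ℚ] (T k).toSubmodule),
      (T k).toSubmodule.subtype.baseChange K
          ((F g k : (K ⊗[ℚ] (T k).toSubmodule) ≃ₗ[K] (K ⊗[ℚ] (T k).toSubmodule)) x) =
        (g : (K ⊗[ℚ] V) ≃ₗ[K] (K ⊗[ℚ] V)) ((T k).toSubmodule.subtype.baseChange K x))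
    (hF' : ∀ (g : ψ.lefschetzGroupBaseChange K) (k : κ) (x : K ⊗[ℚ] (T k).toSubmodule),
      (T k).toSubmodule.subtype.baseChange K
          ((F' g k : (K ⊗[ℚ] (T k).toSubmodule) ≃ₗ[K] (K ⊗[ℚ] (T k).toSubmodule)) x) =
        (g : (K ⊗[ℚ] V) ≃ₗ[K] (K ⊗[ℚ] V)) ((T k).toSubmodule.subtype.baseChange K x)) :
    F = F' := by
  have hinj : ∀ k : κ, Function.Injective ((T (k : ι)).toSubmodule.subtype.baseChange K) := fun k => by
    rw [LinearMap.baseChange_eq_ltensor]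
    exact Module.Flat.lTensor_preserves_injective_linearMap _ (T (k : ι)).toSubmodule.injective_subtype
  exact funext fun g => funext fun k => Subtype.ext (LinearEquiv.ext fun x => hinj k (by rw [hF, hF']))

/-- **The inverse GLUES**: for an isomorphism `F : S(H)(K) ≃* Π_{k ∈ κ} S(T_k)(K)` lying over the base-changed restrictions, `F⁻¹ δ`
restricts to `δ_k` on each `K ⊗ T_k`: `(ι_k)_K (δ_k x) = (F⁻¹ δ) ((ι_k)_K x)`. [cite: Milne1999LefschetzClasses, §1 Prop. 1.5 and Remark 1.6 (p. 644)] -/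
theorem Polarization.subtype_baseChange_apply_eq_symm_apply_of_forall_baseChange_apply
    (F : ψ.lefschetzGroupBaseChange K ≃* Π k : κ, (ψ.restrict (T k)).lefschetzGroupBaseChange K)
    (hF : ∀ (g : ψ.lefschetzGroupBaseChange K) (k : κ) (x : K ⊗[ℚ] (T k).toSubmodule),
      (T k).toSubmodule.subtype.baseChange K
          ((F g k : (K ⊗[ℚ] (T k).toSubmodule) ≃ₗ[K] (K ⊗[ℚ] (T k).toSubmodule)) x) =
        (g : (K ⊗[ℚ] V) ≃ₗ[K] (K ⊗[ℚ] V)) ((T k).toSubmodule.subtype.baseChange K x))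
    (δ : Π k : κ, (ψ.restrict (T k)).lefschetzGroupBaseChange K) (k : κ) (x : K ⊗[ℚ] (T k).toSubmodule) :
    (T k).toSubmodule.subtype.baseChange K ((δ k : (K ⊗[ℚ] (T k).toSubmodule) ≃ₗ[K] (K ⊗[ℚ] (T k).toSubmodule)) x) =
      ((F.symm δ : ψ.lefschetzGroupBaseChange K) : (K ⊗[ℚ] V) ≃ₗ[K] (K ⊗[ℚ] V)) ((T k).toSubmodule.subtype.baseChange K x) := by
  rw [← hF (F.symm δ) k x, MulEquiv.apply_symm_apply]

end Any

/-! ## §3 Prop. 1.5 on `K`-points over the representatives, canonical form -/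

section Labelled

variable {V : Type u} [AddCommGroup V] [Module ℚ V] [Module.Finite ℚ V] {n : ℤ} {H : HodgeStructure V n}
  {ι : Type*} [Fintype ι] [DecidableEq ι] (T : ι → SubHodgeStructure H)
  (hT : DirectSum.IsInternal fun i => (T i).toSubmodule) {κ : Finset ι} {c : ι → κ}
  (hc : ∀ i, ∃ g : Hom (T i).toHodgeStructure (T (c i)).toHodgeStructure, Function.Bijective g.toLinearMap)
  (hκ : ∀ k k' : κ, (∃ g : Hom (T k).toHodgeStructure (T k').toHodgeStructure,
    Function.Bijective g.toLinearMap) → k = k')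

include hT hc hκ

/-- **MILNE'S PROPOSITION 1.5 ON `K`-POINTS, CANONICAL FORM** («`S'(A) ≅ S(A)_{/k'}`», «an immediate consequence of Proposition 1.1»):
for every field `K ⊇ ℚ` and every isotypically labelled irreducible decomposition `V = ⊕ᵢ Tᵢ` of a polarized finite-dimensional
`ℚ`-Hodge structure, RESTRICTION TO THE (base-changed) REPRESENTATIVES is an isomorphism of groups
`F : S(H, ψ)(K) ≃* Π_{k ∈ κ} S(T_k, ψ|_{T_k})(K)`, `(ι_k)_K ((F g)_k x) = g ((ι_k)_K x)` — the isomorphism of §1 induced by g53-#6's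
restriction isomorphism of `K`-algebras with involution `C(H)(K) ≃ₐ[K] Π_k C(T_k)(K)`.
[cite: Milne1999LefschetzClasses, §1 Prop. 1.5 and Remark 1.6 (p. 644)] [cite: Lange2023AbelianVarietiesComplex, §7.2.4 Exercise (4)] -/
theorem Polarization.exists_mulEquiv_pi_lefschetzGroupBaseChange_of_labelling (ψ : Polarization H)
    (hirr : ∀ i, (T i).toHodgeStructure.IsIrreducible) :
    ∃ F : ψ.lefschetzGroupBaseChange K ≃* Π k : κ, (ψ.restrict (T k)).lefschetzGroupBaseChange K,
      ∀ (g : ψ.lefschetzGroupBaseChange K) (k : κ) (x : K ⊗[ℚ] (T k).toSubmodule),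
        (T k).toSubmodule.subtype.baseChange K
            ((F g k : (K ⊗[ℚ] (T k).toSubmodule) ≃ₗ[K] (K ⊗[ℚ] (T k).toSubmodule)) x) =
          (g : (K ⊗[ℚ] V) ≃ₗ[K] (K ⊗[ℚ] V)) ((T k).toSubmodule.subtype.baseChange K x) := by
  obtain ⟨E, hE, hadj⟩ := ψ.exists_centralizer_baseChange_algEquiv_pi_adjoint_of_labelling K T hT hc hκ hirr
  obtain ⟨F, hF⟩ := ψ.exists_mulEquiv_pi_lefschetzGroupBaseChange_of_algEquiv_centralizerAdjoint K
    (H' := fun k : κ => (T k).toHodgeStructure) (fun k : κ => ψ.restrict (T k)) E hadj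
  refine ⟨F, fun g k x => ?_⟩
  have h := LinearMap.congr_fun (hF g k) x
  rw [LinearEquiv.coe_coe] at h
  rw [h, hE]
  rfl

/-- **Every family `δ_k ∈ S(T_k, ψ|_{T_k})(K)`, `k ∈ κ`, is the family of restrictions of a UNIQUE `g ∈ S(H, ψ)(K)`** (bijectivity of
restriction on `K`-points, spelled out on `GL(K ⊗ V)`). [cite: Milne1999LefschetzClasses, §1 Prop. 1.5 and Remark 1.6 (p. 644)] -/
theorem Polarization.existsUnique_mem_lefschetzGroupBaseChange_forall_baseChange_apply (ψ : Polarization H)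
    (hirr : ∀ i, (T i).toHodgeStructure.IsIrreducible) (δ : Π k : κ, (ψ.restrict (T k)).lefschetzGroupBaseChange K) :
    ∃! g : (K ⊗[ℚ] V) ≃ₗ[K] (K ⊗[ℚ] V), g ∈ ψ.lefschetzGroupBaseChange K ∧
      ∀ (k : κ) (x : K ⊗[ℚ] (T k).toSubmodule),
        (T k).toSubmodule.subtype.baseChange K ((δ k : (K ⊗[ℚ] (T k).toSubmodule) ≃ₗ[K] (K ⊗[ℚ] (T k).toSubmodule)) x) =
          g ((T k).toSubmodule.subtype.baseChange K x) := by
  obtain ⟨F, hF⟩ := ψ.exists_mulEquiv_pi_lefschetzGroupBaseChange_of_labelling K T hT hc hκ hirr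
  refine ⟨(F.symm δ : ψ.lefschetzGroupBaseChange K), ⟨(F.symm δ).2, fun k x =>
    ψ.subtype_baseChange_apply_eq_symm_apply_of_forall_baseChange_apply K T F hF δ k x⟩, fun g' hg' => ?_⟩
  obtain ⟨hg'S, hg'⟩ := hg'
  have hinj : ∀ k : κ, Function.Injective ((T (k : ι)).toSubmodule.subtype.baseChange K) := fun k => by
    rw [LinearMap.baseChange_eq_ltensor]
    exact Module.Flat.lTensor_preserves_injective_linearMap _ (T (k : ι)).toSubmodule.injective_subtype
  have h : F ⟨g', hg'S⟩ = δ :=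
    funext fun k => Subtype.ext (LinearEquiv.ext fun x => hinj k (by rw [hF, hg']))
  have h' : (⟨g', hg'S⟩ : ψ.lefschetzGroupBaseChange K) = F.symm δ := by
    rw [← h, MulEquiv.symm_apply_apply]
  exact congrArg Subtype.val h'

end Labelled

end HodgeStructure

end Literature.AlgebraicGeometry.Motives
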